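import Mathlib.Analysis.SpecialFunctions.Trigonometric.Bounds
import Mathlib.Analysis.SpecialFunctions.Complex.Circle
import Mathlib.Analysis.SpecialFunctions.Integrals.Basic
import Mathlib.MeasureTheory.Integral.IntervalIntegral.Basic
import Mathlib.Algebra.Ring.GeomSum
import Mathlib.Analysis.Complex.Trigonometric
import Mathlib.Analysis.Real.Pi.Bounds
import Mathlib.Tactic
import HarnessLib

/-!
# The Fejér and Jackson kernels

The classical kernels behind the one-sided trigonometric approximation of intervals and the
Erdős–Turán inequality [Travaglini2014, §7.1]: the Fejér kernel
`F_M(x) = |Σ_{j=0}^{M} e(jx)|²/(M+1) = Σ_{|h|≤M} (1 − |h|/(M+1)) e(hx)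
 = sin²(π(M+1)x)/((M+1) sin²(πx))`, `e(t) = exp(2πit)`, and the Jackson kernel
`J_M = F_M²/∫₀¹F_M²` — "the Jackson kernel resembles the Fejér kernel, but it is more
concentrated near the origin", `J_N(x) ≤ c min(N, 1/(N³|x|⁴))` [Travaglini2014, eq. (7.3)].
All constants here are explicit and absolute.

* `e`, `dirSum`, `fejer`: `fejer_nonneg`, `fejer_le` (`≤ M+1`), `normSq_dirSum_eq` / `fejer_eq`
  (cosine polynomial), `integral_fejer` (`= 1`), `fejer_mul_sin_sq` (closed form),
  `fejer_le_inv` (`≤ 1/(4(M+1)x²)`), `fejer_add_int`, `fejer_neg`, `fejer_ge_peak`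
  (`≥ 4(M+1)/π²` on `|u| ≤ 1/(2(M+1))`), `fejer_eq_double_sum`.
* `jacksonConst` (`= ∫₀¹ F²`, between `8(M+1)/π⁴` and `M+1`), `jackson`: `jackson_nonneg`,
  `integral_jackson` (`= 1`), `jackson_le_inv` (`≤ π⁴/(128(M+1)³u⁴)`), `jackson_ge_peak`,
  `integral_jackson_peak_ge` (`∫_{−δ}^{δ} J ≥ 16/π⁴`, `δ = 1/(2(M+1))`), periodicity, evenness.
* `integral_e_int` — orthogonality `∫₀¹ e(mt) dt = [m = 0]`.

No named facts.

## References

* [Travaglini2014] G. Travaglini, Number Theory, Fourier Analysis and Geometric Discrepancy,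
  LMS Student Texts 81 (CUP 2014), §7.1 (Fejér and Jackson kernels, eq. (7.3)–(7.4)).
-/

noncomputable section

open Real Finset MeasureTheory intervalIntegral Complex

namespace Literature.Analysis.Fourier.TrigApprox

/-- `e(t) := exp(2π i t)`. [folklore] -/
def e (t : ℝ) : ℂ := Complex.exp (2 * π * I * t)

/-- `e(s+t) = e(s) e(t)`. [folklore] -/
theorem e_add (s t : ℝ) : e (s + t) = e s * e t := by
  unfold e; rw [← Complex.exp_add]; push_cast; ring_nf

/-- `|e(t)| = 1`. [folklore] -/
theorem norm_e (t : ℝ) : ‖e t‖ = 1 := by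
  unfold e
  rw [show (2 * π * I * t : ℂ) = ((2 * π * t : ℝ) : ℂ) * I by push_cast; ring]
  exact Complex.norm_exp_ofReal_mul_I _

/-- `e(jt) = e(t)^j`. [folklore] -/
theorem e_nat_mul (j : ℕ) (t : ℝ) : e (j * t) = e t ^ j := by
  unfold e
  rw [← Complex.exp_nat_mul]; push_cast; ring_nf

/-- The Dirichlet-type sum `D_M(x) = Σ_{j=0}^{M} e(jx)`. [folklore] -/
def dirSum (M : ℕ) (x : ℝ) : ℂ := ∑ j ∈ Finset.range (M + 1), e (j * x)

/-- **The Fejér kernel** `F_M(x) = |Σ_{j=0}^{M} e(jx)|² / (M+1)`. [folklore] -/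
def fejer (M : ℕ) (x : ℝ) : ℝ := ‖dirSum M x‖ ^ 2 / (M + 1)

/-- `F_M ≥ 0`. [folklore] -/
theorem fejer_nonneg (M : ℕ) (x : ℝ) : 0 ≤ fejer M x := by
  unfold fejer; positivity

/-- `|D_M| ≤ M+1`. [folklore] -/
theorem norm_dirSum_le (M : ℕ) (x : ℝ) : ‖dirSum M x‖ ≤ M + 1 := by
  unfold dirSum
  calc ‖∑ j ∈ Finset.range (M + 1), e (j * x)‖ ≤ ∑ j ∈ Finset.range (M + 1), ‖e (j * x)‖ :=
        norm_sum_le _ _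
    _ = M + 1 := by simp [norm_e]

/-- `F_M ≤ M + 1`. [folklore] -/
theorem fejer_le (M : ℕ) (x : ℝ) : fejer M x ≤ M + 1 := by
  unfold fejer
  have hM : (0 : ℝ) < M + 1 := by positivity
  rw [div_le_iff₀ hM]
  have h := norm_dirSum_le M x
  have h0 : 0 ≤ ‖dirSum M x‖ := norm_nonneg _
  nlinarith

/-- The recursion `|D_M|² = |D_{M−1}|² + 1 + 2 Σ_{h=1}^{M} cos(2π h x)`. [folklore] -/
theorem normSq_dirSum_succ (M : ℕ) (x : ℝ) :
    ‖dirSum (M + 1) x‖ ^ 2 = ‖dirSum M x‖ ^ 2 + 1 +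
      2 * ∑ h ∈ Finset.Icc 1 (M + 1), Real.cos (2 * π * h * x) := by
  have hD : dirSum (M + 1) x = dirSum M x + e ((M + 1 : ℕ) * x) := by
    unfold dirSum; rw [Finset.sum_range_succ]
  rw [hD]
  -- `‖a + b‖² = ‖a‖² + ‖b‖² + 2 Re(a conj b)`
  rw [← Complex.normSq_eq_norm_sq, ← Complex.normSq_eq_norm_sq, Complex.normSq_add]
  have hb : Complex.normSq (e ((M + 1 : ℕ) * x)) = 1 := by
    rw [Complex.normSq_eq_norm_sq, norm_e]; norm_num
  rw [hb]
  congr 1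
  -- `Re(D_M · conj e((M+1)x)) = Σ_{j=0}^{M} cos(2π (M+1−j) x) = Σ_{h=1}^{M+1} cos(2π h x)`
  have hre : (dirSum M x * (starRingEnd ℂ) (e ((M + 1 : ℕ) * x))).re =
      ∑ j ∈ Finset.range (M + 1), Real.cos (2 * π * ((M + 1 : ℕ) - j) * x) := by
    unfold dirSum
    rw [Finset.sum_mul, Complex.re_sum]
    refine Finset.sum_congr rfl fun j hj => ?_
    -- `e(jx) conj(e((M+1)x)) = e((j − (M+1)) x)`
    have : e (j * x) * (starRingEnd ℂ) (e ((M + 1 : ℕ) * x)) =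
        Complex.exp ((2 * π * (((j : ℝ) - (M + 1 : ℕ)) * x) : ℝ) * I) := by
      unfold e
      rw [← Complex.exp_conj, ← Complex.exp_add]
      congr 1
      simp only [map_mul, Complex.conj_ofReal, Complex.conj_I, map_ofNat]
      push_cast; ring
    rw [this, Complex.exp_ofReal_mul_I_re, ← Real.cos_neg]
    congr 1; push_cast; ring
  rw [hre]
  -- reindex `j ↦ h = M + 1 − j`
  congr 1
  refine Finset.sum_nbij' (fun j => M + 1 - j) (fun h => M + 1 - h) ?_ ?_ ?_ ?_ ?_
  · intro j hj; rw [Finset.mem_range] at hj; rw [Finset.mem_Icc]; omega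
  · intro h hh; rw [Finset.mem_Icc] at hh; rw [Finset.mem_range]; omega
  · intro j hj; rw [Finset.mem_range] at hj; omega
  · intro h hh; rw [Finset.mem_Icc] at hh; omega
  · intro j hj
    rw [Finset.mem_range] at hj
    rw [Nat.cast_sub (by omega)]

/-- **Fejér's kernel as a cosine polynomial**: `(M+1) F_M(x) = (M+1) + 2 Σ_{h=1}^{M} (M+1−h) cos(2πhx)`.
[folklore] -/
theorem normSq_dirSum_eq (M : ℕ) (x : ℝ) :
    ‖dirSum M x‖ ^ 2 = (M + 1) + 2 * ∑ h ∈ Finset.Icc 1 M, ((M + 1 : ℝ) - h) * Real.cos (2 * π * h * x) := by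
  induction M with
  | zero =>
      simp [dirSum, norm_e]
  | succ M ih =>
      rw [normSq_dirSum_succ, ih, Finset.sum_Icc_succ_top (show 1 ≤ M + 1 by omega),
        Finset.sum_Icc_succ_top (show 1 ≤ M + 1 by omega)]
      push_cast
      have : ∑ h ∈ Finset.Icc 1 M, ((M : ℝ) + 1 + 1 - h) * Real.cos (2 * π * h * x) =
          ∑ h ∈ Finset.Icc 1 M, ((M : ℝ) + 1 - h) * Real.cos (2 * π * h * x) +
          ∑ h ∈ Finset.Icc 1 M, Real.cos (2 * π * h * x) := by
        rw [← Finset.sum_add_distrib]; exact Finset.sum_congr rfl fun h _ => by ring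
      rw [this]
      ring

/-- `F_M(x) = 1 + (2/(M+1)) Σ_{h=1}^{M} (M+1−h) cos(2πhx)`. [folklore] -/
theorem fejer_eq (M : ℕ) (x : ℝ) :
    fejer M x = 1 + 2 / (M + 1) * ∑ h ∈ Finset.Icc 1 M, ((M + 1 : ℝ) - h) * Real.cos (2 * π * h * x) := by
  unfold fejer
  rw [normSq_dirSum_eq]
  set S := ∑ h ∈ Finset.Icc 1 M, ((M + 1 : ℝ) - h) * Real.cos (2 * π * h * x) with hS
  have hM : (M : ℝ) + 1 ≠ 0 := by positivity
  field_simp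

/-- `∫₀¹ cos(2π h x) dx = 0` for `h ≥ 1`. [folklore] -/
theorem integral_cos_two_pi_mul_nat {h : ℕ} (hh : 1 ≤ h) :
    ∫ x in (0 : ℝ)..1, Real.cos (2 * π * h * x) = 0 := by
  have hc : (2 * π * h : ℝ) ≠ 0 := by positivity
  rw [intervalIntegral.integral_comp_mul_left (fun t => Real.cos t) hc, integral_cos]
  simp only [mul_zero, Real.sin_zero, sub_zero, mul_one]
  rw [show (2 * π * h : ℝ) = (2 * h : ℕ) * π by push_cast; ring, Real.sin_nat_mul_pi]
  simp

/-- **`∫₀¹ F_M = 1`.** [folklore] -/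
theorem integral_fejer (M : ℕ) : ∫ x in (0 : ℝ)..1, fejer M x = 1 := by
  simp_rw [fejer_eq]
  rw [intervalIntegral.integral_add, intervalIntegral.integral_const_mul,
    intervalIntegral.integral_finsetSum]
  · simp only [intervalIntegral.integral_const, sub_zero, smul_eq_mul, one_mul]
    rw [Finset.sum_eq_zero, mul_zero, add_zero]
    intro h hh
    rw [intervalIntegral.integral_const_mul, integral_cos_two_pi_mul_nat (Finset.mem_Icc.mp hh).1,
      mul_zero]
  · intro h _
    exact (Continuous.intervalIntegrable (by fun_prop) _ _)
  · exact intervalIntegrable_const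
  · refine (Continuous.intervalIntegrable ?_ _ _)
    exact continuous_const.mul (continuous_finsetSum _ fun h _ => by fun_prop)

/-- **The closed form / tail bound**: `(M+1) F_M(x) · sin²(πx) = sin²(π(M+1)x)`, hence
`F_M(x) ≤ 1/((M+1) sin²(πx))`. [folklore] -/
theorem fejer_mul_sin_sq (M : ℕ) (x : ℝ) :
    fejer M x * (M + 1) * Real.sin (π * x) ^ 2 = Real.sin (π * (M + 1) * x) ^ 2 := by
  unfold fejer
  have hM : (0 : ℝ) < M + 1 := by positivity
  rw [div_mul_cancel₀ _ hM.ne']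
  -- `D_M(x) (e(x) − 1) = e((M+1)x) − 1`
  have hgeom : dirSum M x * (e x - 1) = e x ^ (M + 1) - 1 := by
    unfold dirSum
    have : ∀ j ∈ Finset.range (M + 1), e (j * x) = e x ^ j := fun j _ => e_nat_mul j x
    rw [Finset.sum_congr rfl this]
    exact geom_sum_mul (e x) (M + 1)
  -- norms: `‖e(t) − 1‖ = 2 |sin(π t)|`
  have hnorm : ∀ t : ℝ, ‖e t - 1‖ = 2 * |Real.sin (π * t)| := by
    intro t
    unfold e
    rw [show (2 * π * I * t : ℂ) = I * ((2 * π * t : ℝ) : ℂ) by push_cast; ring,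
      Complex.norm_exp_I_mul_ofReal_sub_one]
    rw [show (2 * π * t : ℝ) / 2 = π * t by ring, norm_mul, Real.norm_eq_abs, Real.norm_eq_abs,
      abs_of_pos two_pos]
  have h1 : ‖dirSum M x‖ * ‖e x - 1‖ = ‖e x ^ (M + 1) - 1‖ := by rw [← norm_mul, hgeom]
  rw [← e_nat_mul, hnorm, hnorm] at h1
  have h2 : (‖dirSum M x‖ * (2 * |Real.sin (π * x)|)) ^ 2 = (2 * |Real.sin (π * ((M + 1 : ℕ) * x))|) ^ 2 := by
    rw [h1]
  rw [mul_pow, mul_pow, mul_pow, sq_abs, sq_abs] at h2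
  push_cast at h2
  rw [show π * ((M + 1 : ℝ) * x) = π * (M + 1) * x by ring] at h2
  nlinarith [h2]

/-- `F_M(x) ≤ 1/(4 (M+1) x²)` for `0 < |x| ≤ 1/2` (from `sin(πx) ≥ 2x` on `[0, 1/2]`). [folklore] -/
theorem fejer_le_inv (M : ℕ) {x : ℝ} (hx0 : x ≠ 0) (hx : |x| ≤ 1 / 2) :
    fejer M x ≤ 1 / (4 * (M + 1) * x ^ 2) := by
  have hM : (0 : ℝ) < M + 1 := by positivity
  -- `sin²(πx) ≥ 4 x²`
  have hsin : 4 * x ^ 2 ≤ Real.sin (π * x) ^ 2 := by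
    -- by symmetry reduce to `x ≥ 0`
    have key : ∀ y : ℝ, 0 ≤ y → y ≤ 1 / 2 → 2 * y ≤ Real.sin (π * y) := by
      intro y hy0 hy1
      have h1 : 0 ≤ π * y := by positivity
      have h2 : π * y ≤ π / 2 := by nlinarith [Real.pi_pos]
      have := Real.mul_le_sin h1 h2
      calc 2 * y = 2 / π * (π * y) := by field_simp
        _ ≤ Real.sin (π * y) := this
    rcases le_or_gt 0 x with h | h
    · have := key x h (le_trans (le_abs_self x) hx)
      nlinarith
    · have hx' : -x ≤ 1 / 2 := le_trans (neg_le_abs x) hx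
      have := key (-x) (by linarith) hx'
      simp only [mul_neg, Real.sin_neg] at this
      nlinarith
  have hx2 : 0 < x ^ 2 := by positivity
  have hfs := fejer_mul_sin_sq M x
  have hle1 : Real.sin (π * (M + 1) * x) ^ 2 ≤ 1 := Real.sin_sq_le_one _
  rw [le_div_iff₀ (by positivity)]
  have hf0 := fejer_nonneg M x
  calc fejer M x * (4 * (M + 1) * x ^ 2) = fejer M x * (M + 1) * (4 * x ^ 2) := by ring
    _ ≤ fejer M x * (M + 1) * Real.sin (π * x) ^ 2 :=
        mul_le_mul_of_nonneg_left hsin (by positivity)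
    _ = Real.sin (π * (M + 1) * x) ^ 2 := hfs
    _ ≤ 1 := hle1

/-! ## Periodicity, evenness, the peak lower bound -/

/-- `e(m) = 1` for `m ∈ ℤ`. [folklore] -/
theorem e_int (m : ℤ) : e m = 1 := by
  unfold e
  have : (2 * π * I * (m : ℝ) : ℂ) = (m : ℂ) * (2 * π * I) := by push_cast; ring
  rw [this, Complex.exp_int_mul_two_pi_mul_I]

/-- `e(t + m) = e(t)`. [folklore] -/
theorem e_add_int (t : ℝ) (m : ℤ) : e (t + m) = e t := by
  rw [e_add, e_int, mul_one]

/-- `D_M` is `1`-periodic. [folklore] -/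
theorem dirSum_add_int (M : ℕ) (x : ℝ) (m : ℤ) : dirSum M (x + m) = dirSum M x := by
  unfold dirSum
  refine Finset.sum_congr rfl fun j _ => ?_
  rw [mul_add, show (j : ℝ) * (m : ℝ) = ((j * m : ℤ) : ℝ) by push_cast; ring, e_add_int]

/-- `F_M` is `1`-periodic. [folklore] -/
theorem fejer_add_int (M : ℕ) (x : ℝ) (m : ℤ) : fejer M (x + m) = fejer M x := by
  unfold fejer; rw [dirSum_add_int]

/-- `F_M(x+1) = F_M(x)`. [folklore] -/
theorem fejer_add_one (M : ℕ) (x : ℝ) : fejer M (x + 1) = fejer M x := by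
  have := fejer_add_int M x 1; simpa using this

/-- `F_M` is even. [folklore] -/
theorem fejer_neg (M : ℕ) (x : ℝ) : fejer M (-x) = fejer M x := by
  rw [fejer_eq, fejer_eq]
  congr 1; congr 1
  refine Finset.sum_congr rfl fun h _ => ?_
  rw [show 2 * π * h * -x = -(2 * π * h * x) by ring, Real.cos_neg]

/-- **The peak**: `F_M(u) ≥ 4(M+1)/π²` for `|u| ≤ 1/(2(M+1))` (from `sin(π(M+1)u) ≥ 2(M+1)|u|`
and `sin(πu) ≤ π|u|`). [folklore] -/
theorem fejer_ge_peak (M : ℕ) {u : ℝ} (hu : |u| ≤ 1 / (2 * (M + 1))) :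
    4 * (M + 1) / π ^ 2 ≤ fejer M u := by
  have hM : (0 : ℝ) < M + 1 := by positivity
  rcases eq_or_ne u 0 with rfl | hu0
  · -- `F_M(0) = M + 1 ≥ 4(M+1)/π²`
    have h0 : fejer M 0 = M + 1 := by
      unfold fejer dirSum
      simp only [mul_zero]
      rw [show e 0 = 1 by simp [e]]
      simp only [Finset.sum_const, Finset.card_range, nsmul_eq_mul, mul_one]
      rw [show ((M + 1 : ℕ) : ℂ) = ((M + 1 : ℝ) : ℂ) by push_cast; ring, Complex.norm_real,
        Real.norm_of_nonneg hM.le]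
      field_simp
    rw [h0, div_le_iff₀ (by positivity)]
    have : (4 : ℝ) ≤ π ^ 2 := by nlinarith [Real.pi_gt_three]
    nlinarith
  · -- `u ≠ 0`: use `(M+1) F sin²(πu) = sin²(π(M+1)u)`
    have hfs := fejer_mul_sin_sq M u
    -- `sin(π(M+1)|u|) ≥ 2(M+1)|u|` and `sin²(πu) ≤ π² u²`
    have key : ∀ y : ℝ, 0 ≤ y → y ≤ 1 / (2 * (M + 1)) →
        2 * (M + 1) * y ≤ Real.sin (π * (M + 1) * y) := by
      intro y hy0 hy1
      have h1 : 0 ≤ π * (M + 1) * y := by positivity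
      have h2 : π * (M + 1) * y ≤ π / 2 := by
        have := mul_le_mul_of_nonneg_left hy1 (show 0 ≤ π * (M + 1) by positivity)
        calc π * (M + 1) * y ≤ π * (M + 1) * (1 / (2 * (M + 1))) := this
          _ = π / 2 := by field_simp
      have := Real.mul_le_sin h1 h2
      calc 2 * (M + 1) * y = 2 / π * (π * (M + 1) * y) := by field_simp
        _ ≤ Real.sin (π * (M + 1) * y) := this
    have hsq1 : (2 * (M + 1) * u) ^ 2 ≤ Real.sin (π * (M + 1) * u) ^ 2 := by
      rcases le_or_gt 0 u with h | h
      · have := key u h (le_trans (le_abs_self u) hu)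
        exact pow_le_pow_left₀ (by positivity) this 2
      · have := key (-u) (by linarith) (le_trans (neg_le_abs u) hu)
        rw [show π * (M + 1) * -u = -(π * (M + 1) * u) by ring, Real.sin_neg] at this
        have h2 := pow_le_pow_left₀ (by nlinarith : 0 ≤ 2 * ((M : ℝ) + 1) * -u) this 2
        calc (2 * (M + 1) * u) ^ 2 = (2 * (M + 1) * -u) ^ 2 := by ring
          _ ≤ (-Real.sin (π * (M + 1) * u)) ^ 2 := h2
          _ = Real.sin (π * (M + 1) * u) ^ 2 := by ring
    have hsq2 : Real.sin (π * u) ^ 2 ≤ (π * u) ^ 2 := Real.sin_sq_le_sq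
    have hu2 : 0 < u ^ 2 := by positivity
    have hπ := Real.pi_pos
    -- `F (M+1) π² u² ≥ F (M+1) sin²(πu) = sin²(π(M+1)u) ≥ 4 (M+1)² u²`
    have h1 : fejer M u * (M + 1) * (π * u) ^ 2 ≥ (2 * (M + 1) * u) ^ 2 := by
      calc (2 * (M + 1) * u) ^ 2 ≤ Real.sin (π * (M + 1) * u) ^ 2 := hsq1
        _ = fejer M u * (M + 1) * Real.sin (π * u) ^ 2 := hfs.symm
        _ ≤ fejer M u * (M + 1) * (π * u) ^ 2 :=
            mul_le_mul_of_nonneg_left hsq2 (by have := fejer_nonneg M u; positivity)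
    rw [div_le_iff₀ (by positivity)]
    have h2 : (fejer M u * π ^ 2 - 4 * (M + 1)) * ((M + 1) * u ^ 2) ≥ 0 := by nlinarith
    have h3 : 0 < (M + 1 : ℝ) * u ^ 2 := by positivity
    nlinarith [(mul_nonneg_iff_of_pos_right h3).mp h2]

/-! ## The Jackson kernel `J_M = F_M² / ∫₀¹ F_M²` -/

/-- The normaliser `c_M = ∫₀¹ F_M²`. [folklore] -/
def jacksonConst (M : ℕ) : ℝ := ∫ x in (0 : ℝ)..1, fejer M x ^ 2

/-- **The Jackson kernel** `J_M = F_M²/c_M` (a nonnegative trigonometric polynomial of degree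
`2M` with `∫₀¹ J_M = 1`, more concentrated at `0` than Fejér's kernel).
[cite: Travaglini2014, §7.1 eq. (7.3)] -/
def jackson (M : ℕ) (x : ℝ) : ℝ := fejer M x ^ 2 / jacksonConst M

/-- `F_M` is continuous. [folklore] -/
theorem continuous_fejer (M : ℕ) : Continuous (fejer M) := by
  have : fejer M = fun x => 1 + 2 / (M + 1) *
      ∑ h ∈ Finset.Icc 1 M, ((M + 1 : ℝ) - h) * Real.cos (2 * π * h * x) := funext (fejer_eq M)
  rw [this]
  exact continuous_const.add (continuous_const.mul (continuous_finsetSum _ fun h _ => by fun_prop))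

/-- `c_M ≤ M + 1` (from `F ≤ M+1` and `∫ F = 1`). [folklore] -/
theorem jacksonConst_le (M : ℕ) : jacksonConst M ≤ M + 1 := by
  unfold jacksonConst
  have h1 : ∫ x in (0 : ℝ)..1, fejer M x ^ 2 ≤ ∫ x in (0 : ℝ)..1, (M + 1) * fejer M x := by
    refine intervalIntegral.integral_mono_on zero_le_one ?_ ?_ fun x _ => ?_
    · exact (continuous_fejer M).pow 2 |>.intervalIntegrable _ _
    · exact (continuous_const.mul (continuous_fejer M)).intervalIntegrable _ _
    · rw [sq]
      exact mul_le_mul_of_nonneg_right (fejer_le M x) (fejer_nonneg M x)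
  rw [intervalIntegral.integral_const_mul, integral_fejer, mul_one] at h1
  exact h1

/-- **`c_M ≥ 8(M+1)/π⁴`** (the peak of `F_M` on `[0, 1/(2(M+1))]`). [folklore] -/
theorem jacksonConst_ge (M : ℕ) : 8 * (M + 1) / π ^ 4 ≤ jacksonConst M := by
  unfold jacksonConst
  have hM : (0 : ℝ) < M + 1 := by positivity
  set δ : ℝ := 1 / (2 * (M + 1)) with hδ
  have hδ0 : 0 < δ := by positivity
  have hδ1 : δ ≤ 1 := by
    rw [hδ, div_le_one (by positivity)]; linarith
  have hint : IntervalIntegrable (fun x => fejer M x ^ 2) volume 0 1 :=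
    ((continuous_fejer M).pow 2).intervalIntegrable _ _
  have hI1 : IntervalIntegrable (fun x => fejer M x ^ 2) volume 0 δ :=
    ((continuous_fejer M).pow 2).intervalIntegrable _ _
  have hI2 : IntervalIntegrable (fun x => fejer M x ^ 2) volume δ 1 :=
    ((continuous_fejer M).pow 2).intervalIntegrable _ _
  have hsplit : ∫ x in (0 : ℝ)..1, fejer M x ^ 2 =
      (∫ x in (0 : ℝ)..δ, fejer M x ^ 2) + ∫ x in δ..1, fejer M x ^ 2 :=
    (intervalIntegral.integral_add_adjacent_intervals hI1 hI2).symm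
  have h2 : 0 ≤ ∫ x in δ..1, fejer M x ^ 2 :=
    intervalIntegral.integral_nonneg hδ1 fun x _ => by positivity
  have h1 : ∫ x in (0 : ℝ)..δ, (4 * (M + 1) / π ^ 2) ^ 2 ≤ ∫ x in (0 : ℝ)..δ, fejer M x ^ 2 := by
    refine intervalIntegral.integral_mono_on hδ0.le intervalIntegrable_const hI1 fun x hx => ?_
    have hxa : |x| ≤ 1 / (2 * (M + 1)) := by rw [abs_of_nonneg hx.1]; exact hx.2
    have := fejer_ge_peak M hxa
    exact pow_le_pow_left₀ (by positivity) this 2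
  rw [intervalIntegral.integral_const, sub_zero, smul_eq_mul] at h1
  have h3 : δ * (4 * (M + 1) / π ^ 2) ^ 2 = 8 * (M + 1) / π ^ 4 := by
    rw [hδ]; field_simp; ring
  rw [h3] at h1
  linarith

/-- `c_M > 0`. [folklore] -/
theorem jacksonConst_pos (M : ℕ) : 0 < jacksonConst M :=
  lt_of_lt_of_le (by positivity) (jacksonConst_ge M)

/-- `J_M ≥ 0`. [folklore] -/
theorem jackson_nonneg (M : ℕ) (x : ℝ) : 0 ≤ jackson M x :=
  div_nonneg (by positivity) (jacksonConst_pos M).le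

/-- `J_M` is `1`-periodic. [folklore] -/
theorem jackson_add_int (M : ℕ) (x : ℝ) (m : ℤ) : jackson M (x + m) = jackson M x := by
  unfold jackson; rw [fejer_add_int]

/-- `J_M` is even. [folklore] -/
theorem jackson_neg (M : ℕ) (x : ℝ) : jackson M (-x) = jackson M x := by
  unfold jackson; rw [fejer_neg]

/-- `J_M` is continuous. [folklore] -/
theorem continuous_jackson (M : ℕ) : Continuous (jackson M) :=
  ((continuous_fejer M).pow 2).div_const _

/-- `∫₀¹ J_M = 1`. [folklore] -/
theorem integral_jackson (M : ℕ) : ∫ x in (0 : ℝ)..1, jackson M x = 1 := by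
  unfold jackson
  rw [intervalIntegral.integral_div, ← jacksonConst]
  exact div_self (jacksonConst_pos M).ne'

/-- **Tail bound**: `J_M(u) ≤ π⁴/(128 (M+1)³ u⁴)` for `0 < |u| ≤ 1/2`. [folklore] -/
theorem jackson_le_inv (M : ℕ) {u : ℝ} (hu0 : u ≠ 0) (hu : |u| ≤ 1 / 2) :
    jackson M u ≤ π ^ 4 / (128 * (M + 1) ^ 3 * u ^ 4) := by
  have hM : (0 : ℝ) < M + 1 := by positivity
  have hc := jacksonConst_ge M
  have hc0 := jacksonConst_pos M
  have hF := fejer_le_inv M hu0 hu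
  have hF0 := fejer_nonneg M u
  have hu2 : 0 < u ^ 2 := by positivity
  unfold jackson
  -- `F² / c ≤ (1/(4(M+1)u²))² / (8(M+1)/π⁴)`
  have h1 : fejer M u ^ 2 ≤ (1 / (4 * (M + 1) * u ^ 2)) ^ 2 := pow_le_pow_left₀ hF0 hF 2
  calc fejer M u ^ 2 / jacksonConst M ≤ (1 / (4 * (M + 1) * u ^ 2)) ^ 2 / (8 * (M + 1) / π ^ 4) := by
        gcongr
    _ = π ^ 4 / (128 * (M + 1) ^ 3 * u ^ 4) := by
        field_simp
        ring

/-- **Peak**: `J_M(u) ≥ 16(M+1)/π⁴` for `|u| ≤ 1/(2(M+1))`. [folklore] -/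
theorem jackson_ge_peak (M : ℕ) {u : ℝ} (hu : |u| ≤ 1 / (2 * (M + 1))) :
    16 * (M + 1) / π ^ 4 ≤ jackson M u := by
  have hM : (0 : ℝ) < M + 1 := by positivity
  have hF := fejer_ge_peak M hu
  have hc := jacksonConst_le M
  have hc0 := jacksonConst_pos M
  unfold jackson
  rw [le_div_iff₀ hc0]
  have h1 : (4 * (M + 1) / π ^ 2) ^ 2 ≤ fejer M u ^ 2 := pow_le_pow_left₀ (by positivity) hF 2
  have h2 : 16 * (M + 1) / π ^ 4 * jacksonConst M ≤ 16 * (M + 1) / π ^ 4 * (M + 1) :=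
    mul_le_mul_of_nonneg_left hc (by positivity)
  have h3 : 16 * (M + 1) / π ^ 4 * (M + 1) = (4 * (M + 1) / π ^ 2) ^ 2 := by ring
  linarith

/-- **Peak mass**: `∫_{−δ}^{δ} J_M ≥ 16/π⁴`, `δ = 1/(2(M+1))`. [folklore] -/
theorem integral_jackson_peak_ge (M : ℕ) :
    16 / π ^ 4 ≤ ∫ u in (-(1 / (2 * (M + 1)) : ℝ))..(1 / (2 * (M + 1))), jackson M u := by
  have hM : (0 : ℝ) < M + 1 := by positivity
  set δ : ℝ := 1 / (2 * (M + 1)) with hδ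
  have hδ0 : 0 < δ := by positivity
  have h1 : ∫ u in (-δ)..δ, (16 * (M + 1) / π ^ 4 : ℝ) ≤ ∫ u in (-δ)..δ, jackson M u := by
    refine intervalIntegral.integral_mono_on (by linarith) intervalIntegrable_const
      ((continuous_jackson M).intervalIntegrable _ _) fun u hu => ?_
    exact jackson_ge_peak M (abs_le.mpr ⟨hu.1, hu.2⟩)
  rw [intervalIntegral.integral_const, smul_eq_mul] at h1
  have h2 : (δ - -δ) * (16 * (M + 1) / π ^ 4) = 16 / π ^ 4 := by
    rw [hδ]; field_simp; ring
  linarith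


/-! ## Exponential-sum structure and orthogonality -/

/-- `e(0) = 1`. [folklore] -/
theorem e_zero : e 0 = 1 := by simp [e]

/-- `e(−t) = conj e(t)`. [folklore] -/
theorem e_neg (t : ℝ) : e (-t) = (starRingEnd ℂ) (e t) := by
  unfold e
  rw [← Complex.exp_conj]
  congr 1
  simp only [map_mul, Complex.conj_ofReal, Complex.conj_I, map_ofNat]
  push_cast; ring

/-- `e(s − t) = e(s) conj e(t)`. [folklore] -/
theorem e_sub (s t : ℝ) : e (s - t) = e s * (starRingEnd ℂ) (e t) := by
  rw [sub_eq_add_neg, e_add, e_neg]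

/-- **`F_M` as a double exponential sum**: `F_M(x) = (1/(M+1)) Σ_{j,k=0}^{M} e((j−k)x)`. [folklore] -/
theorem fejer_eq_double_sum (M : ℕ) (x : ℝ) :
    (fejer M x : ℂ) = (1 / (M + 1 : ℂ)) * ∑ j ∈ Finset.range (M + 1), ∑ k ∈ Finset.range (M + 1),
      e (((j : ℝ) - k) * x) := by
  unfold fejer
  rw [Complex.ofReal_div, Complex.ofReal_pow]
  push_cast
  -- `‖D‖² = D · conj D`
  have h1 : ((‖dirSum M x‖ : ℂ)) ^ 2 = dirSum M x * (starRingEnd ℂ) (dirSum M x) := by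
    rw [Complex.mul_conj, Complex.normSq_eq_norm_sq]; push_cast; ring
  rw [h1]
  unfold dirSum
  rw [map_sum, Finset.sum_mul_sum]
  rw [div_eq_mul_inv, mul_comm, one_div]
  congr 1
  refine Finset.sum_congr rfl fun j _ => Finset.sum_congr rfl fun k _ => ?_
  rw [sub_mul, e_sub]

/-- **Orthogonality**: `∫₀¹ e(m t) dt = [m = 0]` for `m ∈ ℤ`. [folklore] -/
theorem integral_e_int (m : ℤ) :
    ∫ t in (0 : ℝ)..1, e (m * t) = if m = 0 then 1 else 0 := by
  split_ifs with hm
  · subst hm; simp [e_zero]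
  · unfold e
    have hc : (2 * π * I * (m : ℂ)) ≠ 0 := by
      simp only [ne_eq, mul_eq_zero, OfNat.ofNat_ne_zero, Complex.ofReal_eq_zero, Real.pi_ne_zero,
        Complex.I_ne_zero, Int.cast_eq_zero, hm, or_self, not_false_eq_true]
    have : ∀ t : ℝ, Complex.exp (2 * π * I * ((m : ℝ) * t : ℝ)) = Complex.exp ((2 * π * I * m) * (t : ℂ)) := by
      intro t; congr 1; push_cast; ring
    simp_rw [this]
    rw [integral_exp_mul_complex hc]
    have h1 : Complex.exp (2 * π * I * m) = 1 := by
      rw [show (2 * π * I * m : ℂ) = (m : ℂ) * (2 * π * I) by ring]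
      exact Complex.exp_int_mul_two_pi_mul_I m
    simp [h1]


end Literature.Analysis.Fourier.TrigApprox
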